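import Literature.NumberTheory.EllipticCurves.Rank1Residual.Typed.Basic
import Literature.NumberTheory.EllipticCurves.Rank1Residual.Dedup
import Literature.NumberTheory.EllipticCurves.Wuthrich2014.ShaBoundProofs
import Literature.NumberTheory.EllipticCurves.AnalyticRankOrderProofs
import Literature.NumberTheory.EllipticCurves.AnomalousOfRationalTorsionProofs
import HarnessLib

/-!
# Sprung 2024, Corollary 1.2 (second sentence): the ONE-SIDED `p`-part of BSD in analytic rank `0`
# for `E/ℚ` of square-free conductor at an odd SUPERSINGULAR prime — `a_3 = ±3` INCLUDED —
# unconditionally (no image hypothesis, no Conjecture 3.33)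

Source (version of record, READ by this seat 2026-08-26): F. Ito Sprung, *On Iwasawa main
conjectures for elliptic curves at supersingular primes: beyond the case `a_p = 0`*, Adv. Math.
**449** (2024), Paper No. 109741, doi:10.1016/j.aim.2024.109741 [Sprung2024] — publisher PDF
deposited at the NSF Public Access Repository (purl 10611567; store `paper:url-4cf1d13002d7`, 48 pp.,
"Received 19 August 2021 … Accepted 15 May 2024"); locators below are `[corpus: paper:url-4cf1d13002d7
pNNNN:Lk]` = line `k` of page `NNNN` of that PDF.

HONEST FRAMING (cross-ladder LITERATURE-TYPING layer D-0088(4), cell `bsd-littype`, seat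
`bsd-littype-11`): this file TYPES one printed statement as a named fact (`def … : Prop`, nothing
asserted; D-0014) and proves its bookkeeping into the rank-`≤ 1` residual cell's typed currency.
Typed ≠ proved ≠ endorsed; no tranche of this layer proves BSD. The sibling file
`Sprung2024/ChromaticRankOneOneSided.lean` vendors the rank-ONE twin (Cor. 1.3, second sentence,
`Sprung2024.cor13_padicValRat_bsd_rank_one_le`); this file is its rank-ZERO companion, which the tree
lacked (the rank-`0` one-sided binders of record at a good supersingular prime are Perrin-Riou 2003
Prop. 4.8 = `PerrinRiou2003.prop48_padicValRat_bsd_rank_zero_le`, which carries KATO'S IMAGE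
HYPOTHESIS (12.5.2), and Wuthrich 2014 Prop. 21, which carries "`ρ̄_{E,p}` reducible or surjective";
Sprung's sentence carries NEITHER, at the price of square-free conductor).

## The printed statements (p. 4 L24–L56, p. 5 L2–L6), verbatim

"**Theorem 1.1.** Let `E/ℚ` be an elliptic curve and `p > 2` a prime of supersingular reduction.
Assume that `E` has square-free conductor and that Conjecture 3.33 holds. Then `L^{♯/♭}(E)` are each
characteristic power series of the Iwasawa module `Hom(Sel^{♯/♭}(E/ℚ_∞), ℚ_p/ℤ_p)`. Our corollaries
concern the leading term formula in the Birch and Swinnerton-Dyer conjecture. **Corollary 1.2.**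
Assume that `L(E,1) ≠ 0`. Then under the assumptions of the theorem,
`|L(E,1)/Ω|_p = |#Ш(E/ℚ) ∏_l c_l|_p`. Without Conjecture (∗), we can say
`|L(E,1)/Ω|_p ⩽ |#Ш(E/ℚ) ∏_l c_l|_p`." `[corpus: paper:url-4cf1d13002d7 p0004:L24–L56]` — "Here,
`Ш(E/ℚ)` is the Šafarevič–Tate group of `E/ℚ`, `c_l` are the Tamagawa numbers, and `Ω` is the Néron
period. The second statement follows from [64, Theorem 7.16], and a new argument is needed to deduce
(BSD_p) from an integral main conjecture, which the reader can find in subsection 5.2."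
`[ibid. p0005:L2–L6]` ([64] = F. Sprung, J. Number Theory 132 (2012), Thm. 7.16 — the ♯/♭ form of
Kato's divisibility; Conjecture (∗) = Conjecture 3.33 = the existence of suitable two-variable
Beilinson–Flach classes, p. 2 L22–L24 and p. 22.)

Only the SECOND sentence of Cor. 1.2 ("Without Conjecture (∗) …") is vendored: it is stated
WITHOUT the unproved Conjecture 3.33, under the remaining assumptions of Thm. 1.1 — `E/ℚ` with
square-free conductor (semistable), `p > 2` of supersingular reduction (`a_3 = ±3` allowed: the
paper's subject is "beyond the case `a_p = 0`"; p. 4 L5–L18) — and `L(E,1) ≠ 0`. In the residual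
cell's dictionary it is the UPPER bound `ord_p #Ш(E/ℚ) ≤ ord_p #Ш_an` in analytic rank `0`
(`|x|_p ⩽ |y|_p ⟺ ord_p x ≥ ord_p y`). The first sentence (the EQUALITY) and Thm. 1.1 itself are
CONDITIONAL on Conjecture 3.33, whose objects (two-variable Beilinson–Flach classes in
`H¹(K,T) ⊗ …` with reciprocity laws at both primes above `p`, p. 22) have no tree vocabulary; they
are deliberately NOT transcribed (a `Prop` "assuming Conj. 3.33" cannot be stated faithfully today —
recorded as a typed GAP on the cell's faithfulness sheet, not as a weakened statement).

NOTE ON THE TORSION TERM (faithfulness, not a correction). The printed right-hand side is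
`#Ш(E/ℚ)∏_l c_l` WITHOUT the factor `#E(ℚ)²_tor` of the BSD quotient (contrast Cor. 1.3, which
prints it). This is harmless and is transcribed AS PRINTED: at an odd prime `p` of good
supersingular reduction `p ∤ #E(ℚ)_tor` (the proof, p. 41 L48–L49: "since `E[p]` is irreducible as a
Galois representation, we necessarily have `|E(ℚ)_p| = 1`"; in the tree: `p ∣ a_p` forces
`p ∤ a_p − 1`, and `not_dvd_torsionOrder_of_not_dvd_frobeniusTrace_sub_one`), so the printed
inequality and the BSD-shaped one `ord_p(L(E,1)/Ω) ≥ ord_p(#Ш∏c_l/#E(ℚ)²_tor)` are EQUIVALENT —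
proved below (`cor12_iff_torsionForm`), so that no reader mistakes the transcription for a
STRONGER-THAN-PRINT statement.

FLAGS for the referee (two-tier reading, as for every statement whose printed proof the tree has
not re-derived): `Sprung24-Cor12ii-via-Spr12-7.16` — the printed justification of the one-sided
clause is one sentence ("The second statement follows from [64, Theorem 7.16]"), i.e. Kato's
divisibility in ♯/♭ form `Char(X^⋆) ⊇ (L^⋆)` [Sprung 2012, Thm. 7.16, under "`Gal(ℚ̄/ℚ)` surjects
onto `Aut E[p]`"] combined with the UNCONDITIONAL Euler-characteristic lemmas of §5.2 (Lemmas 5.5–5.9,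
pp. 40–41, which use neither square-free `N` nor Conj. 3.33; their product gives
`|f^⋆(0)|_p⁻¹ ∼ #Sel_{p^∞}(E/ℚ)·∏c_l^{(p)}`, p. 41 L47–L50) and the interpolation `L^⋆(0) ∼ L(E,1)/Ω`
up to a `p`-adic unit at a supersingular `p` [Sprung 2012, table before Prop. 6.14]. The image
hypothesis of [64, Thm. 7.16] is discharged IN the paper for square-free `N` (p. 37 L57 – p. 38 L5:
"this surjectivity assumption can be replaced by the pair of assumption that `E[p]` be irreducible
and ramified at a prime `q ∥ N` different from `p`, as explained in [62, discussion after Theorem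
2.5.2]. … The irreducibility was originally proved by Fontaine. … Since `N` is square-free, Ribet's
level-lowering theorem [57, Theorem 8.2] implies that `E[p]` ramifies at some prime `q ∣ N`"; in the
tree the stronger `surj(p)` at a semistable supersingular odd `p` is even a THEOREM,
`hasSurjectiveModNGaloisRep_of_hasIrreducibleModPGaloisRep_of_isSemistable` with
`hasIrreducibleModPGaloisRep_of_dvd_frobeniusTrace`). Nothing is asserted: users take
`(h : cor12_padicValRat_bsd_rank_zero_le)`; no `_holds` is expected (no ♯/♭ Selmer groups
`Sel^{♯/♭}(E/ℚ_∞)` in the tree — Sprung 2012, Open Problem 7.22).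

Transcription (shape of `PerrinRiou2003.prop48_padicValRat_bsd_rank_zero_le` and of the sibling
`cor13_…`): `W` globally minimal; semistable over `𝓞 ℚ` (`_hsst`, square-free conductor); `p ≠ 2`
(`_hp`) of good reduction (`_hgood`) with `p ∣ a_p` (`_hss`, supersingular); `L(E,1) ≠ 0` (`_hL`,
on the entire continuation `W.entireLFunction`); `Finite Ш` (`_hfin`, the printed `#Ш` presupposes
it; Kato / Kolyvagin in rank `0`). Conclusion: `L(E,1)/Ω_E = q ∈ ℚ` (rationality presupposed by the
printed `|·|_p`; Manin–Drinfeld) with `ord_p q ≥ ord_p #Ш + ord_p ∏_ℓ c_ℓ` — NO torsion term, as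
printed. `Ω` = the Néron period = the tree's `realPeriodRat` up to the number of real components
`c_∞ ∈ {1, 2}`, invisible at odd `p`.

Contents: the fact `cor12_padicValRat_bsd_rank_zero_le`; `cor12_iff_torsionForm` (equivalence with
the BSD-shaped inequality at a good supersingular odd `p`, a THEOREM); bookkeeping
`missingUpperBoundAt_of_cor12` (⇒ `Typed.MissingUpperBoundAt W p`: `ord_p #Ш ≤ ord_p #Ш_an`, at any
semistable good-supersingular odd pair of analytic rank `0`, with NO image hypothesis) and
`bsdp_of_cor12_of_shaAn_le` (with `ord_p #Ш_an ≤ 0` the whole typed output, hence Miller's `BSD(E,p)`).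

## References
* F. I. Sprung, Adv. Math. 449 (2024) 109741: Thm. 1.1 and Cor. 1.2 (p. 4), p. 5 L2–L6, Thm. 5.1
  (p. 37) and its proof (pp. 37–38), Thm. 5.3 (p. 38), §5.2 Lemmas 5.5–5.9 (pp. 40–41). [Sprung2024]
* F. Sprung, J. Number Theory 132 (2012) 1483–1506, Thm. 7.16, Thm. 7.14, Open Problem 7.22. [Sprung2012]
* B. Perrin-Riou, Experiment. Math. 12 (2003), Prop. 4.8 (the image-hypothesis twin). [PerrinRiou2003]
* R. L. Miller, LMS J. Comput. Math. 14 (2011), Def. 1.1. [Miller2011LMS]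
-/

noncomputable section

open scoped Classical NumberField

open WeierstrassCurve Literature.NumberTheory.EllipticCurves.Rank1Residual
  Literature.NumberTheory.EllipticCurves.Rank1Residual.Typed
  Literature.NumberTheory.EllipticCurves.Wuthrich2014

namespace Literature.NumberTheory.EllipticCurves.Sprung2024

/-- **Sprung, Adv. Math. 449 (2024) 109741, Corollary 1.2, second sentence** (p. 4), verbatim:
"Assume that `L(E,1) ≠ 0`. Then under the assumptions of the theorem [Thm. 1.1: `E/ℚ` an elliptic
curve, `p > 2` a prime of supersingular reduction, square-free conductor, and the paper's Conj. 3.33],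
`|L(E,1)/Ω|_p = |#Ш(E/ℚ)∏_l c_l|_p`. Without [Conj.] (∗), we can say
`|L(E,1)/Ω|_p ⩽ |#Ш(E/ℚ)∏_l c_l|_p`." ("`Ω` is the Néron period … The second statement follows from
[64, Theorem 7.16]", p. 5.) Only the unconditional ("Without (∗)") inequality is transcribed: `W`
globally minimal, `E` semistable (`W.IsSemistable (𝓞 ℚ)` = square-free conductor), `p ≠ 2` good
with `p ∣ a_p` (supersingular; `a_3 = ±3` included), `L(E,1) ≠ 0`, `Ш` finite (printed
presupposition); then `L(E,1)/Ω_E = q ∈ ℚ` with `ord_p q ≥ ord_p #Ш + ord_p ∏_ℓ c_ℓ` — no torsion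
term, exactly as printed (equivalent to the BSD-shaped form at such `p`: `cor12_iff_torsionForm`).
Printed justification: Kato's divisibility in ♯/♭ form [64, Thm. 7.16] + §5.2 Lemmas 5.5–5.9, image
hypothesis discharged in-paper for square-free `N` (Fontaine + Ribet); flag
`Sprung24-Cor12ii-via-Spr12-7.16` (module docstring). Nothing asserted.
[cite: Sprung2024, Cor. 1.2 (p. 4), second sentence; p. 5 L2–L6; proof of Thm. 5.1 pp. 37–38] -/
def cor12_padicValRat_bsd_rank_zero_le : Prop :=
  ∀ (W : WeierstrassCurve ℚ) [W.IsElliptic] [W.IsGloballyMinimal] (p : ℕ) [Fact p.Prime]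
    (_hp : p ≠ 2) (_hsst : W.IsSemistable (𝓞 ℚ)) (_hgood : W.HasGoodReductionAtPrime p)
    (_hss : (p : ℤ) ∣ W.frobeniusTrace p) (_hL : W.entireLFunction 1 ≠ 0) (_hfin : Finite W.sha),
    ∃ q : ℚ, W.entireLFunction 1 / (W.realPeriodRat : ℂ) = (q : ℂ) ∧
      (padicValNat p W.shaOrder : ℤ) + padicValNat p W.tamagawaProduct ≤ padicValRat p q

variable (W : WeierstrassCurve ℚ) [W.IsElliptic] [W.IsGloballyMinimal] (p : ℕ) [Fact p.Prime]

/-- At an odd prime `p` of good SUPERSINGULAR reduction, `p ∤ #E(ℚ)_tors`: `p ∣ a_p` excludes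
`a_p ≡ 1 (mod p)`, and a rational point of order `p` at a good `p ≥ 3` would force `a_p ≡ 1 (mod p)`
(tree theorem `not_dvd_torsionOrder_of_not_dvd_frobeniusTrace_sub_one`). This is the sentence
"we necessarily have `|E(ℚ)_p| = 1`" of the printed proof (p. 41).
[cite: Sprung2024, proof of Thm. 5.3 (p. 41 L48–L49)] -/
theorem padicValNat_torsionOrder_eq_zero_of_supersingular (hp : p ≠ 2)
    (hgood : W.HasGoodReductionAtPrime p) (hss : (p : ℤ) ∣ W.frobeniusTrace p) :
    padicValNat p W.torsionOrder = 0 := by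
  refine padicValNat.eq_zero_of_not_dvd ?_
  have hp2 : 2 ≤ p := (Fact.out : p.Prime).two_le
  have hp3 : 3 ≤ p := by omega
  refine not_dvd_torsionOrder_of_not_dvd_frobeniusTrace_sub_one W p hp3 hgood ?_
  intro h1
  have hone : (p : ℤ) ∣ 1 := by
    have := dvd_sub hss h1
    simpa using this
  have hp1 : (p : ℤ) ≤ 1 := Int.le_of_dvd one_pos hone
  omega

/-- **Faithfulness check: the printed (torsion-free) inequality is EQUIVALENT to the BSD-shaped
one** `ord_p q ≥ ord_p #Ш + ord_p ∏c_ℓ − 2·ord_p #E(ℚ)_tors` at an odd good supersingular `p`,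
because `ord_p #E(ℚ)_tors = 0` there. So transcribing Cor. 1.2 without the torsion factor, as
printed, is neither stronger nor weaker than the BSD reading. [cite: Sprung2024, Cor. 1.2 (p. 4) and p. 41 L48–L49] -/
theorem cor12_iff_torsionForm (hp : p ≠ 2) (hgood : W.HasGoodReductionAtPrime p)
    (hss : (p : ℤ) ∣ W.frobeniusTrace p) (q : ℚ) :
    (padicValNat p W.shaOrder : ℤ) + padicValNat p W.tamagawaProduct ≤ padicValRat p q ↔
      (padicValNat p W.shaOrder : ℤ) + padicValNat p W.tamagawaProduct -
        2 * padicValNat p W.torsionOrder ≤ padicValRat p q := by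
  rw [padicValNat_torsionOrder_eq_zero_of_supersingular W p hp hgood hss]
  simp

/-- **Bookkeeping: Cor. 1.2 (ii) is the typed UPPER bound in analytic rank `0`.** At a semistable
good supersingular odd `p` with `r_an = 0` (GZK `hGZK` for finiteness of `Ш` and rank `0`;
modularity `hmod` for `r_an = 0 ⇒ L(E,1) ≠ 0`), the fact gives `MissingUpperBoundAt W p`
(`ord_p #Ш ≤ ord_p #Ш_an`, `#Ш_an = (L(E,1)/Ω)·#E(ℚ)²/∏c_ℓ` by
`Wuthrich2014.shaAn_eq_of_L_one_div_eq`) — with NO image hypothesis (contrast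
`PerrinRiou2003.missingUpperBoundAt_of_prop48`, `Typed.missingUpperBoundAt_of_wuthrich`).
[cite: Sprung2024, Cor. 1.2 (p. 4), second sentence] [cite: Miller2011LMS, Def. 1.1] -/
theorem missingUpperBoundAt_of_cor12 (h : cor12_padicValRat_bsd_rank_zero_le)
    (hGZK : rank_eq_analyticRank_of_analyticRank_le_one) (hmod : hasEntireLFunction_rat)
    (hp : p ≠ 2) (hsst : Semistable W) (hss : GoodSS W p) (hr : W.analyticRank = 0) :
    MissingUpperBoundAt W p := by
  have hL : W.entireLFunction 1 ≠ 0 := (W.analyticRank_eq_zero_iff_holds (hmod W)).1 hr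
  obtain ⟨-, hfin⟩ := hGZK W (by omega)
  obtain ⟨q, hq, hv⟩ := h W p hp ((semistable_iff_isSemistable_ringOfIntegers W).mp hsst) hss.1
    hss.2 hL hfin
  obtain ⟨-, hE, -, hshaAn⟩ := shaAn_eq_of_L_one_div_eq hGZK W hL hq
  haveI := hE
  have hq0 : q ≠ 0 := by
    rintro rfl
    apply hL
    have hΩ : (W.realPeriodRat : ℂ) ≠ 0 := by exact_mod_cast W.realPeriodRat_pos_holds.ne'
    have h0 := hq
    rw [Rat.cast_zero, div_eq_zero_iff] at h0
    exact h0.resolve_right hΩ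
  have ht0 : 0 < W.torsionOrder := W.torsionOrder_pos_holds
  have hc0 : 0 < W.tamagawaProduct := W.tamagawaProduct_pos_holds
  refine ⟨_, hshaAn, ?_⟩
  have hcard : (Nat.card W.toAffine.Point : ℚ) = (W.torsionOrder : ℚ) := by
    exact_mod_cast (W.torsionOrder_eq_natCard_of_finite).symm
  have ht : (W.torsionOrder : ℚ) ≠ 0 := by exact_mod_cast ht0.ne'
  have hc : (W.tamagawaProduct : ℚ) ≠ 0 := by exact_mod_cast hc0.ne'
  have htors0 : ((padicValNat p W.torsionOrder : ℕ) : ℤ) = 0 := by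
    exact_mod_cast padicValNat_torsionOrder_eq_zero_of_supersingular W p hp hss.1 hss.2
  rw [hcard, padicValRat.div (mul_ne_zero hq0 (pow_ne_zero 2 ht)) hc,
    padicValRat.mul hq0 (pow_ne_zero 2 ht), padicValRat.pow (W.torsionOrder : ℚ), padicValRat.of_nat,
    padicValRat.of_nat, htors0]
  simp only [mul_zero, add_zero]
  linarith

/-- **Bookkeeping: with `ord_p #Ш_an ≤ 0` the one-sided clause is the whole typed output.** If in
addition `#Ш_an` is a rational with `ord_p #Ш_an ≤ 0` — e.g. an exact `p`-adic unit — then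
`ord_p #Ш ≤ ord_p #Ш_an ≤ 0 ≤ ord_p #Ш` forces `MissingPPartAt W p`, hence Miller's `BSD(E,p)` by
`bsdp_of_missingPPartAt`: on SEMISTABLE supersingular rank-`0` pairs (class X8 ∩ {sst, `r_an = 0`}
with `a_3 = ±3` included) the rank-zero lever needs no image certificate.
[cite: Sprung2024, Cor. 1.2 (p. 4), second sentence] [cite: Miller2011LMS, Def. 1.1] -/
theorem bsdp_of_cor12_of_shaAn_le (h : cor12_padicValRat_bsd_rank_zero_le)
    (hGZK : rank_eq_analyticRank_of_analyticRank_le_one) (hmod : hasEntireLFunction_rat)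
    (hp : p ≠ 2) (hsst : Semistable W) (hss : GoodSS W p) (hr : W.analyticRank = 0)
    (hsha : ∃ q : ℚ, shaAn W = (q : ℂ) ∧ padicValRat p q ≤ 0) : BSDp W p := by
  obtain ⟨q, hq, hle⟩ := missingUpperBoundAt_of_cor12 W p h hGZK hmod hp hsst hss hr
  obtain ⟨q', hq', hle'⟩ := hsha
  have hqq : q' = q := by exact_mod_cast hq'.symm.trans hq
  subst hqq
  have h0 : (0 : ℤ) ≤ padicValNat p W.shaOrder := by exact_mod_cast Nat.zero_le _
  exact bsdp_of_missingPPartAt W p hGZK (by omega) ⟨q', hq', by linarith⟩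

end Literature.NumberTheory.EllipticCurves.Sprung2024

end
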